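import Summits.HodgeConjecture.HodgeConjecture.Theorems.VHCAbelianSchemesRoadSemiregularSheafRepresentativesTwAtStubLefschetzRegimeTw
import Summits.HodgeConjecture.HodgeConjecture.Theorems.VHCAbelianSchemesRoadSemiregularSheafRepresentativesLefAtStubLefschetzRegime
import HarnessLib

/-!
# Road b02 (`VHCAbelianSchemesRoad`) — the regime split in the kernel: after stub 1, EACH SKELETON'S REMAINING STUB IS ITS ITEM

research route conditional on HC_CM; not a corollary; Q11.4-sentence-2 already refuted in dim ≥ 3.

Door-generic bookkeeping over the landed regime vocabulary (`VHCAbelianSchemesRoadRegimeDefs`, p433748) and the landed stub 1 of both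
registered skeletons (`stub_lefschetzRegimeTw` p434003, `stub_lefschetzRegime` p434017). THEOREMS ONLY, all elementary (case split /
hypothesis dropping / monotonicity); nothing is asserted, `HC_CM` occurs nowhere, K-SR♭∃ and the exceptional regime stay OPEN.

* §1 `admissibleRepresentativesLefAt_of_regimes` — regimes 1 + 2 ⟹ K-SR♭∃ for the door (the skeletons' composition, importable);
  conversely K-SR♭∃ ⟹ each regime (drop the regime hypothesis). Hence **for every door with null data, K-SR♭∃ ⟺ regime 2**
  (`admissibleRepresentativesLefAt_iff_lefAtExceptionalRegime_of_hasNullDatum`): after stub 1 the birth line has NO slack — the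
  load-bearing stub `stub_exceptionalRegime(Tw)` is kernel-EQUIVALENT to the item it serves.
* §2 Monotonicity of the three regime predicates in the door, and the sheaf ⟹ twisted transports for `Adm ⊇ bfSingleAdmissible`: a proof
  of the aside's (19779) stub 2, resp. BC5 rung, IS a proof of the crux's (19274) stub 2, resp. BC5 rung.
* §3 The rung is a literal specialisation of regime 2 (door-generic `rung_of`), and regime 2 at `(n, p) = (6, 3)` is all the rung asks.
* §4 The two items by name: `Ring2.SemiregularRepresentatives.SemiregularSheafRepresentativesLefAt` (= route item 19779 by `rfl`)
  `⟺ ∀ C, LefAtExceptionalRegime (bfSheafClass C)`; the twin statement `∀ C, AdmissibleRepresentativesLefAt (twistedReflexiveClass C AdmTw)`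
  (= route item 19274 `Theses.VHCAbelianSchemesRoad.SemiregularSheafRepresentativesTwAt` by `rfl`) `⟺ ∀ C, LefAtExceptionalRegime (twistedReflexiveClass C AdmTw)`;
  and 19779's statement ⟹ 19274's (already landed as `admissibleRepresentativesLefAt_twisted_of_sheaf`, restated regime-wise).

References: [cite: Bloch1972Semiregularity, Remark (7.5)] [cite: BuchweitzFlenner2003, §5 Thm. 5.1] [cite: vanGeemen1994HodgeAV, §2.4 and Thm. 4.11].
-/

noncomputable section

open CategoryTheory CategoryTheory.Limits AlgebraicGeometry Topology

-- the cell's namespace repeats the summit name (`Summit.HodgeConjecture.HodgeConjecture…`), as in every `Ring2*` file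
set_option linter.dupNamespace false

namespace Summit.HodgeConjecture.HodgeConjecture.Ring2.SemiregularRepresentatives

open Literature.AlgebraicGeometry Literature.AlgebraicGeometry.Motives
open Literature.AlgebraicGeometry.HodgeTheory
open Literature.AlgebraicTopology.SingularHomology
open Literature.Barriers.HodgeConjecture (divisorClassesSpan)
open Summit.Ventures.HSemireg (ObjClass bfSheafClass)

/-! ## §1 The case split and its converse -/

/-- **Regimes 1 + 2 ⟹ K-SR♭∃ for the door `𝒪`** (classical case split on «`W` algebraic-Lefschetz on every fibre»; the composition
`admissibleRepresentativesLefAt_of_regimes` of both registered skeletons, importable). [cite: vanGeemen1994HodgeAV, §2.4] -/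
theorem admissibleRepresentativesLefAt_of_regimes {𝒪 : ObjClass}
    (h₁ : LefAtLefschetzRegime 𝒪) (h₂ : LefAtExceptionalRegime 𝒪) : AdmissibleRepresentativesLefAt 𝒪 := by
  intro n 𝒳 S f hf h𝒳 hirr haff hsm hdim habel he p W hW s₀ hs₀
  by_cases hL : ∀ s : ComplexPoints S,
      complexBetti.map (fiberι f s) (2 * p) W ∈ algebraicClasses (fiberOver f s) p ∧
      complexBetti.map (fiberι f s) (2 * p) W ∈ divisorClassesSpan (fiberOver f s) n p
  · exact h₁ f hf h𝒳 hirr haff hsm hdim habel he p W hW s₀ hs₀ hL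
  · exact h₂ f hf h𝒳 hirr haff hsm hdim habel he p W hW s₀ hs₀ hL

/-- **K-SR♭∃ ⟹ regime 1** (drop the regime hypothesis). [folklore] -/
theorem lefAtLefschetzRegime_of_admissibleRepresentativesLefAt {𝒪 : ObjClass} (h : AdmissibleRepresentativesLefAt 𝒪) :
    LefAtLefschetzRegime 𝒪 :=
  fun _ _ _ f hf h𝒳 hirr haff hsm hdim habel he p W hW s₀ hs₀ _ => h f hf h𝒳 hirr haff hsm hdim habel he p W hW s₀ hs₀

/-- **K-SR♭∃ ⟹ regime 2** (drop the regime hypothesis). [folklore] -/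
theorem lefAtExceptionalRegime_of_admissibleRepresentativesLefAt {𝒪 : ObjClass} (h : AdmissibleRepresentativesLefAt 𝒪) :
    LefAtExceptionalRegime 𝒪 :=
  fun _ _ _ f hf h𝒳 hirr haff hsm hdim habel he p W hW s₀ hs₀ _ => h f hf h𝒳 hirr haff hsm hdim habel he p W hW s₀ hs₀

/-- **For a door with null data, K-SR♭∃ ⟺ its exceptional regime**: regime 1 is free (`lefAtLefschetzRegime_of_hasNullDatum`), so
after stub 1 the birth line's load-bearing stub is kernel-equivalent to the item it serves — no slack is left in the regime split.
[cite: vanGeemen1994HodgeAV, §2.4 and Thm. 4.11] [cite: Bloch1972Semiregularity, Remark (7.5)] -/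
theorem admissibleRepresentativesLefAt_iff_lefAtExceptionalRegime_of_hasNullDatum {𝒪 : ObjClass} (h𝒪 : HasNullDatum 𝒪) :
    AdmissibleRepresentativesLefAt 𝒪 ↔ LefAtExceptionalRegime 𝒪 :=
  ⟨lefAtExceptionalRegime_of_admissibleRepresentativesLefAt,
    admissibleRepresentativesLefAt_of_regimes (lefAtLefschetzRegime_of_hasNullDatum h𝒪)⟩

/-! ## §2 Monotonicity in the door; sheaf ⟹ twisted -/

/-- Regime 1 is monotone in the door. [folklore] -/
theorem LefAtLefschetzRegime.mono {𝒪 𝒪' : ObjClass} (h𝒪 : ∀ n X₀ I κ, 𝒪 n X₀ I κ → 𝒪' n X₀ I κ)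
    (h : LefAtLefschetzRegime 𝒪) : LefAtLefschetzRegime 𝒪' := by
  intro n 𝒳 S f hf h𝒳 hirr haff hsm hdim habel he p W hW s₀ hs₀ hL
  obtain ⟨s₁, I, κ, V, a, Z, hpI, hκ, ha, hZ, hVp, hκV, hVH⟩ := h f hf h𝒳 hirr haff hsm hdim habel he p W hW s₀ hs₀ hL
  exact ⟨s₁, I, κ, V, a, Z, hpI, h𝒪 _ _ _ _ hκ, ha, hZ, hVp, hκV, hVH⟩

/-- Regime 2 is monotone in the door. [folklore] -/
theorem LefAtExceptionalRegime.mono {𝒪 𝒪' : ObjClass} (h𝒪 : ∀ n X₀ I κ, 𝒪 n X₀ I κ → 𝒪' n X₀ I κ)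
    (h : LefAtExceptionalRegime 𝒪) : LefAtExceptionalRegime 𝒪' := by
  intro n 𝒳 S f hf h𝒳 hirr haff hsm hdim habel he p W hW s₀ hs₀ hL
  obtain ⟨s₁, I, κ, V, a, Z, hpI, hκ, ha, hZ, hVp, hκV, hVH⟩ := h f hf h𝒳 hirr haff hsm hdim habel he p W hW s₀ hs₀ hL
  exact ⟨s₁, I, κ, V, a, Z, hpI, h𝒪 _ _ _ _ hκ, ha, hZ, hVp, hκV, hVH⟩

/-- The BC5 rung is monotone in the door. [folklore] -/
theorem LefAtExceptionalRegimeSixfoldMiddle.mono {𝒪 𝒪' : ObjClass} (h𝒪 : ∀ n X₀ I κ, 𝒪 n X₀ I κ → 𝒪' n X₀ I κ)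
    (h : LefAtExceptionalRegimeSixfoldMiddle 𝒪) : LefAtExceptionalRegimeSixfoldMiddle 𝒪' := by
  intro 𝒳 S f hf h𝒳 hirr haff hsm hdim habel he W hW s₀ hs₀ hL
  obtain ⟨s₁, I, κ, V, a, Z, hpI, hκ, ha, hZ, hVp, hκV, hVH⟩ := h f hf h𝒳 hirr haff hsm hdim habel he W hW s₀ hs₀ hL
  exact ⟨s₁, I, κ, V, a, Z, hpI, h𝒪 _ _ _ _ hκ, ha, hZ, hVp, hκV, hVH⟩

/-- **The aside's stub 2 proves the crux's stub 2**: regime 2 for the sheaf door `bfSheafClass C` implies regime 2 for the twisted door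
`twistedReflexiveClass C Adm`, every `Adm ⊇ bfSingleAdmissible` (widening `bfSheafClass_le_twistedReflexiveClass`, p418685).
[cite: BuchweitzFlenner2003, §5 Thm. 5.1 (hypotheses)] [cite: Bloch1972Semiregularity, Remark (7.5)] -/
theorem lefAtExceptionalRegime_twisted_of_sheaf (C : ChernCharacterBetti) {Adm : PerfectAdmissibility}
    (hAdm : ∀ n X₀ I E, bfSingleAdmissible n X₀ I E → Adm n X₀ I E) (h : LefAtExceptionalRegime (bfSheafClass C)) :
    LefAtExceptionalRegime (twistedReflexiveClass C Adm) :=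
  h.mono (bfSheafClass_le_twistedReflexiveClass C hAdm)

/-- **The aside's BC5 rung proves the crux's BC5 rung** (same widening). [cite: BuchweitzFlenner2003, §5 Thm. 5.1 (hypotheses)] -/
theorem lefAtExceptionalRegimeSixfoldMiddle_twisted_of_sheaf (C : ChernCharacterBetti) {Adm : PerfectAdmissibility}
    (hAdm : ∀ n X₀ I E, bfSingleAdmissible n X₀ I E → Adm n X₀ I E) (h : LefAtExceptionalRegimeSixfoldMiddle (bfSheafClass C)) :
    LefAtExceptionalRegimeSixfoldMiddle (twistedReflexiveClass C Adm) :=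
  h.mono (bfSheafClass_le_twistedReflexiveClass C hAdm)

/-! ## §3 The rung inside regime 2 -/

/-- **The BC5 rung is regime 2 at `(n, p) = (6, 3)`** (door-generic `rung_of_exceptionalRegime` of both skeletons). [folklore] -/
theorem lefAtExceptionalRegimeSixfoldMiddle_of_lefAtExceptionalRegime {𝒪 : ObjClass} (h : LefAtExceptionalRegime 𝒪) :
    LefAtExceptionalRegimeSixfoldMiddle 𝒪 :=
  fun _ _ f hf h𝒳 hirr haff hsm hdim habel he W hW s₀ hs₀ hexc => h f hf h𝒳 hirr haff hsm hdim habel he 3 W hW s₀ hs₀ hexc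

/-- **K-SR♭∃ for the door already gives its BC5 rung** (so the rung is implied by the item it separates; it is «separating» only as
a first attackable instance). [folklore] -/
theorem lefAtExceptionalRegimeSixfoldMiddle_of_admissibleRepresentativesLefAt {𝒪 : ObjClass} (h : AdmissibleRepresentativesLefAt 𝒪) :
    LefAtExceptionalRegimeSixfoldMiddle 𝒪 :=
  lefAtExceptionalRegimeSixfoldMiddle_of_lefAtExceptionalRegime (lefAtExceptionalRegime_of_admissibleRepresentativesLefAt h)

/-! ## §4 The two items of the road, regime-wise -/

/-- **Item 19779 ⟺ its stub 2**: `SemiregularSheafRepresentativesLefAt` (K-SR♭∃ for the sheaf door, every `C`; the route item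
`Theses.VHCAbelianSchemesRoad.SemiregularSheafRepresentativesLefAt` is this constant by `rfl`) holds iff the exceptional regime holds
for `bfSheafClass C`, every `C` (regime 1 = `stub_lefschetzRegime`, landed p434017). [cite: vanGeemen1994HodgeAV, §2.4 and Thm. 4.11]
[cite: BuchweitzFlenner2003, §5 Def. 4.10] -/
theorem semiregularSheafRepresentativesLefAt_iff_exceptionalRegime :
    SemiregularSheafRepresentativesLefAt ↔ ∀ C : ChernCharacterBetti, LefAtExceptionalRegime (bfSheafClass C) :=
  ⟨fun h C => lefAtExceptionalRegime_of_admissibleRepresentativesLefAt (h C),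
    fun h C => admissibleRepresentativesLefAt_of_regimes
      (Summit.HodgeConjecture.HodgeConjecture.Theorems.SemiregularSheafRepresentativesLefAt.stub_lefschetzRegime C) (h C)⟩

/-- **Item 19274 ⟺ its stub 2**: the twin statement `∀ C, AdmissibleRepresentativesLefAt (twistedReflexiveClass C AdmTw)`,
`AdmTw := gluableSigmaAdmissible ∨ bfSingleAdmissible` (the route item `Theses.VHCAbelianSchemesRoad.SemiregularSheafRepresentativesTwAt`
by `rfl`), holds iff the exceptional regime holds for the twisted door, every `C` (regime 1 = `stub_lefschetzRegimeTw`, landed p434003).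
[cite: vanGeemen1994HodgeAV, §2.4 and Thm. 4.11] [cite: Bloch1972Semiregularity, Remark (7.5)] -/
theorem twAt_iff_exceptionalRegimeTw :
    (∀ C : ChernCharacterBetti, AdmissibleRepresentativesLefAt (Literature.AlgebraicGeometry.HodgeTheory.twistedReflexiveClass C
      (fun n X₀ I E => Summit.Ventures.HSemireg.gluableSigmaAdmissible n X₀ I E ∨
        Literature.AlgebraicGeometry.HodgeTheory.bfSingleAdmissible n X₀ I E))) ↔
    ∀ C : ChernCharacterBetti, LefAtExceptionalRegime (Literature.AlgebraicGeometry.HodgeTheory.twistedReflexiveClass C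
      (fun n X₀ I E => Summit.Ventures.HSemireg.gluableSigmaAdmissible n X₀ I E ∨
        Literature.AlgebraicGeometry.HodgeTheory.bfSingleAdmissible n X₀ I E)) :=
  ⟨fun h C => lefAtExceptionalRegime_of_admissibleRepresentativesLefAt (h C),
    fun h C => admissibleRepresentativesLefAt_of_regimes
      (Summit.HodgeConjecture.HodgeConjecture.Theorems.SemiregularSheafRepresentativesTwAt.stub_lefschetzRegimeTw C) (h C)⟩

/-- **The aside's stub 2 (every `C`) already proves the crux 19274** (sheaf ⟹ twisted at regime 2, then §1 with the landed stub 1).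
[cite: Bloch1972Semiregularity, Remark (7.5)] [cite: BuchweitzFlenner2003, §5 Thm. 5.1] -/
theorem twAt_of_exceptionalRegime_sheaf (h : ∀ C : ChernCharacterBetti, LefAtExceptionalRegime (bfSheafClass C)) :
    ∀ C : ChernCharacterBetti, AdmissibleRepresentativesLefAt (Literature.AlgebraicGeometry.HodgeTheory.twistedReflexiveClass C
      (fun n X₀ I E => Summit.Ventures.HSemireg.gluableSigmaAdmissible n X₀ I E ∨
        Literature.AlgebraicGeometry.HodgeTheory.bfSingleAdmissible n X₀ I E)) :=
  twAt_iff_exceptionalRegimeTw.2 fun C => lefAtExceptionalRegime_twisted_of_sheaf C (fun _ _ _ _ h' => Or.inr h') (h C)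

end Summit.HodgeConjecture.HodgeConjecture.Ring2.SemiregularRepresentatives

end
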